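import Mathlib
import Summits.ResolutionOfSingularities.ResolutionOfSingularities.Theses.DefectlessFrames
import Literature.AlgebraicGeometry.Resolution.TranscendenceDefect

/-!
# SkelVet reconstruction of the foreseen BC3 birth skeleton of `PureTranscendentalFrames`
(crux stmt-ResolutionOfSingularities-18874, route DefectlessFrames)

Seat refuter-skel-stmt-ResolutionOfSingularities-18874-vet-0 (mode skeleton-vet), 2026-08-17.
The planner's own `bc/PureTranscendentalFrames_birth.lean` (item evidence
20260817T030617Z-PureTranscendentalFrames_birth.lean, 18849 B) was never published as a crux
workfile nor registered with `ledger skeleton check`, and the evidence store is not mounted in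
seat jails, so its text cannot be audited.  This file is a RECONSTRUCTION of the seam the route
text announces (Theses docstring, TWO-LAYER PLAN: "PureTranscendentalFrames ⇐ the same
dichotomy" = `stub_abhyankar` (transcendence defect 0) / `stub_transcendenceDefect`
(transcendence defect > 0), assembled by cases), typed with the tree's
`Literature.AlgebraicGeometry.Resolution.transcendenceDefect k O hk` of the valuation ring `O`
of `K` over `k` (the split parameter is this seat's choice; the planner's file may split on the
transcendence defect of `O ∩ k(x)` instead — either way `D = 0` forces every sub-frame field
`k(x'₀,…,x'ₙ₋₁)` to be Abhyankar, by additivity of Abhyankar's inequality).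

The two stub statements are the crux body VERBATIM with one hypothesis inserted after `hk`.
`sorry` occurs only in `stub_abhyankar` and `stub_transcendenceDefect`;
`PureTranscendentalFrames_of` concludes the crux BY NAME through the sorry-free
`pureTranscendentalFrames_of_stubs`.
-/

namespace Summit.ResolutionOfSingularities.ResolutionOfSingularities.Cruxes.PureTranscendentalFrames.SkelVetRecon

open Summit.ResolutionOfSingularities.ResolutionOfSingularities.Theses.DefectlessFrames

/-- `PureTranscendentalFrames` restricted to ABHYANKAR valuation data (`D(O/k) = 0`). -/
def StubAbhyankar : Prop :=
  ∀ p : ℕ, p.Prime → ∀ (k K : Type) [Field k] [CharP k p] [PerfectField k] [Field K] [Algebra k K], (⊤ : IntermediateField k K).FG → ∀ O : ValuationSubring K, ∀ hk : (∀ c : k, algebraMap k K c ∈ O), Literature.AlgebraicGeometry.Resolution.transcendenceDefect k O hk = 0 → Nonempty O.valuation.RankOne → (∀ x ∈ O, ∃ f : Polynomial k, f ≠ 0 ∧ Polynomial.aeval x f ∈ O.nonunits) → let ρ : k →+* IsLocalRing.ResidueField O := (IsLocalRing.residue O).comp ((algebraMap k K).codRestrict O hk); let axis : (m : ℕ) →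 (Fin (m + 1) → O) → MvPolynomial (Fin (m + 1)) k → Polynomial (IsLocalRing.ResidueField O) := fun _ w g => MvPolynomial.eval₂ (Polynomial.C.comp ρ) (Fin.snoc (fun j => Polynomial.C (IsLocalRing.residue O (w (Fin.castSucc j)))) Polynomial.X) g; ∀ (n : ℕ) (x : Fin (n + 1) → O) (g : MvPolynomial (Fin (n + 1)) k), AlgebraicIndependent k (fun i => (x i : K)) → g ≠ 0 → ∃ (x' : Fin (n + 1) → O) (G : MvPolynomial (Fin (n + 1)) k), AlgebraicIndependent k (fun i => (x' i : K)) ∧ (∀ i, (x i : K) ∈ Algebra.adjoin k (Set.range fun i => (x' i : K))) ∧ MvPolynomial.aeval (fun i => (x' i : K)) G = MvPolynomial.aeval (fun i => (x i : K)) g ∧ axis n x' G ≠ 0 ∧ (axis n x g ≠ 0 → (axis n x' G).rootMultiplicity (IsLocalRing.residue O (x' (Fin.last n))) ≤ (axis n x g).rootMultiplicity (IsLocalRing.residue O (x (Fin.last n)))) ∧ let K₁ : IntermediateField k K := IntermediateField.adjoin k (Set.range fun j : Fin n => (x' (Fin.castSucc j) : K)); let w : K := (x' (Fin.last n) : K);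 ((∃ h ∈ K₁, ∀ a ∈ K₁, O.valuation (w - h) ≤ O.valuation (w - a)) ∨ (∀ q : Polynomial K₁, q ≠ 0 → ∃ a : K₁, O.valuation (Polynomial.aeval w q - algebraMap K₁ K (Polynomial.eval a q)) < O.valuation (Polynomial.aeval w q)))

/-- `PureTranscendentalFrames` restricted to valuation data WITH transcendence defect
(`D(O/k) > 0`) — the half the route's why-might-fail is about. -/
def StubTranscendenceDefect : Prop :=
  ∀ p : ℕ, p.Prime → ∀ (k K : Type) [Field k] [CharP k p] [PerfectField k] [Field K] [Algebra k K], (⊤ : IntermediateField k K).FG → ∀ O : ValuationSubring K, ∀ hk : (∀ c : k, algebraMap k K c ∈ O), 0 < Literature.AlgebraicGeometry.Resolution.transcendenceDefect k O hk → Nonempty O.valuation.RankOne → (∀ x ∈ O, ∃ f : Polynomial k, f ≠ 0 ∧ Polynomial.aeval x f ∈ O.nonunits) → let ρ : k →+* IsLocalRing.ResidueField O := (IsLocalRing.residue O).comp ((algebraMap k K).codRestrict O hk); let axis : (m : ℕ) → (Fin (m + 1) → O) → MvPolynomial (Fin (m + 1)) k → Polynomial (IsLocalRing.ResidueField O) :=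 fun _ w g => MvPolynomial.eval₂ (Polynomial.C.comp ρ) (Fin.snoc (fun j => Polynomial.C (IsLocalRing.residue O (w (Fin.castSucc j)))) Polynomial.X) g; ∀ (n : ℕ) (x : Fin (n + 1) → O) (g : MvPolynomial (Fin (n + 1)) k), AlgebraicIndependent k (fun i => (x i : K)) → g ≠ 0 → ∃ (x' : Fin (n + 1) → O) (G : MvPolynomial (Fin (n + 1)) k), AlgebraicIndependent k (fun i => (x' i : K)) ∧ (∀ i, (x i : K) ∈ Algebra.adjoin k (Set.range fun i => (x' i : K))) ∧ MvPolynomial.aeval (fun i => (x' i : K)) G = MvPolynomial.aeval (fun i => (x i : K)) g ∧ axis n x' G ≠ 0 ∧ (axis n x g ≠ 0 → (axis n x' G).rootMultiplicity (IsLocalRing.residue O (x' (Fin.last n))) ≤ (axis n x g).rootMultiplicity (IsLocalRing.residue O (x (Fin.last n)))) ∧ let K₁ : IntermediateField k K := IntermediateField.adjoin k (Set.range fun j : Fin n => (x' (Fin.castSucc j) : K)); let w : K := (x' (Fin.last n) : K); ((∃ h ∈ K₁, ∀ a ∈ K₁, O.valuation (w - h) ≤ O.valuation (w - a)) ∨ (∀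 q : Polynomial K₁, q ≠ 0 → ∃ a : K₁, O.valuation (Polynomial.aeval w q - algebraMap K₁ K (Polynomial.eval a q)) < O.valuation (Polynomial.aeval w q)))

/-- stub 1 (foreseen provable-now: generalized stability ⇒ the completion of every Abhyankar
sub-frame field is defectless, hence algebraically maximal, so purity D1 ∨ D2 is automatic for
every transcendental `w`; general position by a Nagata re-framing). -/
theorem stub_abhyankar : StubAbhyankar := by
  sorry

/-- stub 2 (the crux proper: non-Abhyankar rank-one zero-dimensional places). -/
theorem stub_transcendenceDefect : StubTranscendenceDefect := by
  sorry

/-- The assembly with the stubs as hypotheses (sorry-free; by cases on `D(O/k)`). -/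
theorem pureTranscendentalFrames_of_stubs (h0 : StubAbhyankar) (h1 : StubTranscendenceDefect) :
    PureTranscendentalFrames := by
  intro p hp k K _ _ _ _ _ hfg O hk hr hz
  rcases Nat.eq_zero_or_pos
      (Literature.AlgebraicGeometry.Resolution.transcendenceDefect k O hk) with hD | hD
  · exact h0 p hp k K hfg O hk hD hr hz
  · exact h1 p hp k K hfg O hk hD hr hz

/-- BC3 assembly: the crux BY NAME from the two named stubs. -/
theorem PureTranscendentalFrames_of : PureTranscendentalFrames :=
  pureTranscendentalFrames_of_stubs stub_abhyankar stub_transcendenceDefect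

end Summit.ResolutionOfSingularities.ResolutionOfSingularities.Cruxes.PureTranscendentalFrames.SkelVetRecon
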